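import Summits.ResolutionOfSingularities.ResolutionOfSingularities.Theorems.FrobeniusLadderFInjectiveMacaulayficationClauseOfPderivNotMem
import Mathlib.RingTheory.MvPolynomial.WeightedHomogeneous
import Mathlib.Algebra.MvPolynomial.PDeriv
import Mathlib.Tactic.LinearCombination
import HarnessLib

/-!
# The weighted blow-up of `f₄ = X₂² + X₀³ + X₁⁶ + X₃³X₀²` in characteristic `5`: the `X₁`-chart

Support file for crux stmt-ResolutionOfSingularities-15315
(`FrobeniusLadder.FInjectiveMacaulayfication`, registered skeleton `10f06f91`, line `Sketch`, §15 THE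
WEIGHTED CONE ENGINE, calibration specimen `f₄`): registered stub `stub_f4ChartY`.

Let `k` be a field of characteristic `5`, `S = k[X₀, X₁, X₂, X₃]`, `f₄ = X₂² + X₀³ + X₁⁶ + X₃³X₀²`
(weighted homogeneous of degree `N = 18` for the weights `w = (6, 3, 9, 2)`). The `X₁`-chart of the
weighted blow-up of the origin is governed by the root-cover substitution
`θ₁ : X₁ ↦ X₁³, Xⱼ ↦ Xⱼ X₁^{wⱼ} (j ≠ 1)`, under which `θ₁ f₄ = X₁¹⁸ · g` with the chart polynomial
`g = X₂² + X₀³ + 1 + X₃³X₀²`. What is proved (`stub_f4ChartY`, the registered signature verbatim):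

* the chart identity `θ₁ f₄ = X₁¹⁸ g` (`ring` after expanding `aeval`);
* `g` is weighted homogeneous of weight `0` for the residual weights `W = e₁ - w = (-6, 1, -9, -2)`
  in `ZMod 3` (monomial by monomial: `isWeightedHomogeneous_X`, `.pow`, `.mul`, `.add`; the four
  weights `2·(-9)`, `3·(-6)`, `0`, `3·(-2) + 2·(-6)` vanish in `ZMod 3` by `decide`);
* `X₁ ∤ g` (the evaluation at the origin kills `X₁` and sends `g` to `1`);
* at EVERY maximal ideal `Q` of `S/(g)` the local ring `(S/(g))_Q` satisfies the per-stalk clause of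
  the crux (every system of parameters weakly regular and generating a Frobenius closed ideal): the
  chart is SMOOTH — if the partials `∂₂g = 2X₂`, `∂₃g = 3X₃²X₀²`, `∂₀g = 3X₀² + 2X₃³X₀` all lay in
  the maximal ideal `P = Q ∩ S ∋ g`, then `X₂ ∈ P`, `X₀ ∈ P` (from `∂₃`, `∂₀`), hence
  `1 = g - X₂² - X₀³ - X₃³X₀² ∈ P`; so some partial misses `P` and the Jacobian discharger
  `ClauseOfPderivNotMem.stub_clauseOfPderivNotMem` applies.

References: [Matsumura1987] H. Matsumura, *Commutative Ring Theory*, Thm. 30.4 (through the imported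
Jacobian discharger). The computation itself is folklore.
-/

-- single-problem summit: the doubled namespace component is forced
set_option linter.dupNamespace false

noncomputable section

namespace Summit.ResolutionOfSingularities.ResolutionOfSingularities.Theorems.FInjectiveMacaulayfication.F4ChartY

open MvPolynomial
open Summit.ResolutionOfSingularities.ResolutionOfSingularities.Theorems.FInjectiveMacaulayfication

/-! ## The partial derivatives of the chart polynomial -/

/-- **`∂g/∂X₀ = 3X₀² + 2X₃³X₀`** for `g = X₂² + X₀³ + 1 + X₃³X₀²`, over any commutative ring. [folklore] -/
theorem pderiv_zero_g {A : Type*} [CommRing A] :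
    pderiv 0 (X 2 ^ 2 + X 0 ^ 3 + 1 + X 3 ^ 3 * X 0 ^ 2 : MvPolynomial (Fin 4) A) =
      3 * X 0 ^ 2 + 2 * (X 3 ^ 3 * X 0) := by
  simp only [map_add, pderiv_one, pderiv_mul, pderiv_pow, pderiv_X_self,
    pderiv_X_of_ne (show (2 : Fin 4) ≠ 0 by decide), pderiv_X_of_ne (show (3 : Fin 4) ≠ 0 by decide),
    Nat.reduceSub, pow_one, mul_one, mul_zero, zero_mul, add_zero, zero_add, Nat.cast_ofNat]
  ring

/-- **`∂g/∂X₂ = 2X₂`** for `g = X₂² + X₀³ + 1 + X₃³X₀²`, over any commutative ring. [folklore] -/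
theorem pderiv_two_g {A : Type*} [CommRing A] :
    pderiv 2 (X 2 ^ 2 + X 0 ^ 3 + 1 + X 3 ^ 3 * X 0 ^ 2 : MvPolynomial (Fin 4) A) = 2 * X 2 := by
  simp only [map_add, pderiv_one, pderiv_mul, pderiv_pow, pderiv_X_self,
    pderiv_X_of_ne (show (0 : Fin 4) ≠ 2 by decide), pderiv_X_of_ne (show (3 : Fin 4) ≠ 2 by decide),
    Nat.reduceSub, pow_one, mul_one, mul_zero, zero_mul, add_zero, Nat.cast_ofNat]

/-- **`∂g/∂X₃ = 3X₃²X₀²`** for `g = X₂² + X₀³ + 1 + X₃³X₀²`, over any commutative ring. [folklore] -/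
theorem pderiv_three_g {A : Type*} [CommRing A] :
    pderiv 3 (X 2 ^ 2 + X 0 ^ 3 + 1 + X 3 ^ 3 * X 0 ^ 2 : MvPolynomial (Fin 4) A) =
      3 * (X 3 ^ 2 * X 0 ^ 2) := by
  simp only [map_add, pderiv_one, pderiv_mul, pderiv_pow, pderiv_X_self,
    pderiv_X_of_ne (show (0 : Fin 4) ≠ 3 by decide), pderiv_X_of_ne (show (2 : Fin 4) ≠ 3 by decide),
    Nat.reduceSub, pow_one, mul_one, mul_zero, add_zero, zero_add, Nat.cast_ofNat]
  ring

/-! ## Weighted homogeneity of the chart polynomial -/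

/-- **`g = X₂² + X₀³ + 1 + X₃³X₀²` is weighted homogeneous of weight `0`** for the residual weights
`W = (-6, 1, -9, -2)` with values in `ZMod 3` (i.e. `W = (0, 1, 0, 1)`): every monomial has weight
`0`. [folklore] -/
theorem isWeightedHomogeneous_g (k : Type) [Field k] :
    MvPolynomial.IsWeightedHomogeneous (![-6, 1, -9, -2] : Fin 4 → ZMod 3)
      (X 2 ^ 2 + X 0 ^ 3 + 1 + X 3 ^ 3 * X 0 ^ 2 : MvPolynomial (Fin 4) k) 0 := by
  have hX : ∀ j : Fin 4, IsWeightedHomogeneous (![-6, 1, -9, -2] : Fin 4 → ZMod 3)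
      (X j : MvPolynomial (Fin 4) k) ((![-6, 1, -9, -2] : Fin 4 → ZMod 3) j) :=
    fun j => isWeightedHomogeneous_X k _ j
  have h2 : IsWeightedHomogeneous (![-6, 1, -9, -2] : Fin 4 → ZMod 3)
      (X 2 ^ 2 : MvPolynomial (Fin 4) k) 0 := by
    have h := (hX 2).pow 2
    rwa [show 2 • (![-6, 1, -9, -2] : Fin 4 → ZMod 3) 2 = 0 from by decide] at h
  have h0 : IsWeightedHomogeneous (![-6, 1, -9, -2] : Fin 4 → ZMod 3)
      (X 0 ^ 3 : MvPolynomial (Fin 4) k) 0 := by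
    have h := (hX 0).pow 3
    rwa [show 3 • (![-6, 1, -9, -2] : Fin 4 → ZMod 3) 0 = 0 from by decide] at h
  have h1 : IsWeightedHomogeneous (![-6, 1, -9, -2] : Fin 4 → ZMod 3)
      (1 : MvPolynomial (Fin 4) k) 0 := isWeightedHomogeneous_one k _
  have h30 : IsWeightedHomogeneous (![-6, 1, -9, -2] : Fin 4 → ZMod 3)
      (X 3 ^ 3 * X 0 ^ 2 : MvPolynomial (Fin 4) k) 0 := by
    have h := ((hX 3).pow 3).mul ((hX 0).pow 2)
    rwa [show 3 • (![-6, 1, -9, -2] : Fin 4 → ZMod 3) 3 + 2 • (![-6, 1, -9, -2] : Fin 4 → ZMod 3) 0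
      = 0 from by decide] at h
  exact ((h2.add h0).add h1).add h30

/-! ## Registered form -/

/-- **THE `X₁`-CHART OF THE WEIGHTED BLOW-UP OF `f₄`** (registered stub `stub_f4ChartY` of line
`Sketch`, §15 weighted cone engine, specimen `f₄ = X₂² + X₀³ + X₁⁶ + X₃³X₀²`, weights `(6,3,9,2)`,
`N = 18`, characteristic `5`). With `g = X₂² + X₀³ + 1 + X₃³X₀²`: (i) the root-cover substitution
`θ₁ : X₁ ↦ X₁³, Xⱼ ↦ XⱼX₁^{wⱼ}` gives `θ₁ f₄ = X₁¹⁸ g` (`ring`); (ii) `g` is weighted homogeneous of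
weight `0` for `W = (-6, 1, -9, -2) : Fin 4 → ZMod 3` (`isWeightedHomogeneous_g`); (iii) `X₁ ∤ g`
(evaluate at the origin: `g ↦ 1`, `X₁ ↦ 0`); (iv) at every maximal ideal `Q` of `k[X]/(g)` the local
ring satisfies the per-stalk clause of the crux — the chart is smooth: were `∂₀g, ∂₂g, ∂₃g` all in
`P = Q ∩ k[X]`, then `X₂, X₀ ∈ P` and `1 = g - X₂² - X₀³ - X₃³X₀² ∈ P`, absurd; so the Jacobian
discharger `ClauseOfPderivNotMem.stub_clauseOfPderivNotMem` applies in some direction.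
[cite: Matsumura1987, Thm. 30.4 (ii)] -/
theorem stub_f4ChartY : ∀ (k : Type) [Field k] [CharP k 5] (f g : MvPolynomial (Fin 4) k), f = MvPolynomial.X 2 ^ 2 + MvPolynomial.X 0 ^ 3 + MvPolynomial.X 1 ^ 6 + MvPolynomial.X 3 ^ 3 * MvPolynomial.X 0 ^ 2 → g = MvPolynomial.X 2 ^ 2 + MvPolynomial.X 0 ^ 3 + 1 + MvPolynomial.X 3 ^ 3 * MvPolynomial.X 0 ^ 2 → MvPolynomial.aeval (fun j : Fin 4 => if j = 1 then (MvPolynomial.X 1 : MvPolynomial (Fin 4) k) ^ 3 else MvPolynomial.X j * MvPolynomial.X 1 ^ ((![6, 3, 9, 2] : Fin 4 → ℕ) j)) f = MvPolynomial.X 1 ^ 18 * g ∧ MvPolynomial.IsWeightedHomogeneous (![-6, 1, -9, -2] : Fin 4 → ZMod 3) g 0 ∧ ¬ (MvPolynomial.X 1 : MvPolynomial (Fin 4) k) ∣ g ∧ ∀ (Q : Ideal (MvPolynomial (Fin 4) k ⧸ Ideal.span {g})) [Q.IsMaximal], ∀ d : ℕ, ringKrullDim (Localization.AtPrime Q) =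 d → ∀ s : Fin d → Localization.AtPrime Q, (Ideal.span (Set.range s)).radical.IsMaximal → RingTheory.Sequence.IsWeaklyRegular (Localization.AtPrime Q) (List.ofFn s) ∧ ∀ y : Localization.AtPrime Q, (∃ e : ℕ, y ^ 5 ^ e ∈ Ideal.span ((fun z : Localization.AtPrime Q => z ^ 5 ^ e) '' (Ideal.span (Set.range s) : Set (Localization.AtPrime Q)))) → y ∈ Ideal.span (Set.range s) := by
  intro k _ _ f g hf hg
  haveI : Fact (Nat.Prime 5) := ⟨Nat.prime_five⟩
  refine ⟨?_, hg ▸ isWeightedHomogeneous_g k, ?_, ?_⟩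
  · -- (i) the chart identity
    subst hf hg
    simp only [map_add, map_mul, map_pow, MvPolynomial.aeval_X, Fin.isValue, Fin.reduceEq,
      ↓reduceIte, Matrix.cons_val_zero, Matrix.cons_val]
    ring
  · -- (iii) `X₁ ∤ g`: evaluate at the origin
    rintro ⟨h, hh⟩
    have h1 := congrArg (MvPolynomial.eval fun _ : Fin 4 => (0 : k)) hh
    rw [hg] at h1
    simp only [map_add, map_mul, map_pow, map_one, MvPolynomial.eval_X, Fin.isValue] at h1
    norm_num at h1
  · -- (iv) the clause at every closed point: the chart is smooth
    intro Q _ d hd s hs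
    haveI hP₀max : (Q.comap (Ideal.Quotient.mk (Ideal.span {g}))).IsMaximal :=
      Ideal.comap_isMaximal_of_surjective _ Ideal.Quotient.mk_surjective
    have hP₀ := hP₀max.isPrime
    -- arithmetic of characteristic `5` in `k[X]`
    have h5 : (5 : MvPolynomial (Fin 4) k) = 0 := by
      exact_mod_cast CharP.cast_eq_zero (MvPolynomial (Fin 4) k) 5
    have hu2 : IsUnit (2 : MvPolynomial (Fin 4) k) :=
      IsUnit.of_mul_eq_one 3 (by linear_combination h5)
    have hu3 : IsUnit (3 : MvPolynomial (Fin 4) k) :=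
      IsUnit.of_mul_eq_one 2 (by linear_combination h5)
    -- the partial derivatives
    have hd0 : pderiv 0 g = 3 * X 0 ^ 2 + 2 * (X 3 ^ 3 * X 0) := by rw [hg, pderiv_zero_g]
    have hd2 : pderiv 2 g = 2 * X 2 := by rw [hg, pderiv_two_g]
    have hd3 : pderiv 3 g = 3 * (X 3 ^ 2 * X 0 ^ 2) := by rw [hg, pderiv_three_g]
    -- off the singular locus: the Jacobian discharger in direction `j`
    by_cases hm2 : pderiv 2 g ∈ Q.comap (Ideal.Quotient.mk (Ideal.span {g})); swap
    · exact ClauseOfPderivNotMem.stub_clauseOfPderivNotMem 5 k 4 g Q 2 hm2 d hd s hs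
    by_cases hm0 : pderiv 0 g ∈ Q.comap (Ideal.Quotient.mk (Ideal.span {g})); swap
    · exact ClauseOfPderivNotMem.stub_clauseOfPderivNotMem 5 k 4 g Q 0 hm0 d hd s hs
    by_cases hm3 : pderiv 3 g ∈ Q.comap (Ideal.Quotient.mk (Ideal.span {g})); swap
    · exact ClauseOfPderivNotMem.stub_clauseOfPderivNotMem 5 k 4 g Q 3 hm3 d hd s hs
    -- all partials vanish at `Q`: impossible, the chart is smooth
    exfalso
    have hgP : g ∈ Q.comap (Ideal.Quotient.mk (Ideal.span {g})) := by
      rw [Ideal.mem_comap, Ideal.Quotient.eq_zero_iff_mem.mpr (Ideal.mem_span_singleton_self g)]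
      exact Q.zero_mem
    have hX2 : (X 2 : MvPolynomial (Fin 4) k) ∈ Q.comap (Ideal.Quotient.mk (Ideal.span {g})) := by
      rw [hd2] at hm2
      exact (Ideal.unit_mul_mem_iff_mem _ hu2).mp hm2
    have hX0 : (X 0 : MvPolynomial (Fin 4) k) ∈ Q.comap (Ideal.Quotient.mk (Ideal.span {g})) := by
      rw [hd3] at hm3
      have h30 := (Ideal.unit_mul_mem_iff_mem _ hu3).mp hm3
      rcases hP₀.mem_or_mem h30 with h3 | h0
      · -- `X₃ ∈ P₀`: `3X₀² = ∂₀g - 2X₃³X₀ ∈ P₀`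
        have hX3 : (X 3 : MvPolynomial (Fin 4) k) ∈ Q.comap (Ideal.Quotient.mk (Ideal.span {g})) :=
          hP₀.mem_of_pow_mem 2 h3
        have e : (3 * X 0 ^ 2 : MvPolynomial (Fin 4) k) = pderiv 0 g - 2 * (X 3 ^ 2 * X 0) * X 3 := by
          rw [hd0]; ring
        refine hP₀.mem_of_pow_mem 2 ((Ideal.unit_mul_mem_iff_mem _ hu3).mp ?_)
        rw [e]
        exact Ideal.sub_mem _ hm0 (Ideal.mul_mem_left _ _ hX3)
      · exact hP₀.mem_of_pow_mem 2 h0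
    have h1 : (1 : MvPolynomial (Fin 4) k) ∈ Q.comap (Ideal.Quotient.mk (Ideal.span {g})) := by
      have e : (1 : MvPolynomial (Fin 4) k) = g - (X 2 * X 2 + X 0 ^ 2 * X 0 + X 3 ^ 3 * X 0 * X 0) := by
        rw [hg]; ring
      rw [e]
      exact Ideal.sub_mem _ hgP (Ideal.add_mem _ (Ideal.add_mem _ (Ideal.mul_mem_left _ _ hX2)
        (Ideal.mul_mem_left _ _ hX0)) (Ideal.mul_mem_left _ _ hX0))
    exact hP₀max.ne_top ((Ideal.eq_top_iff_one _).mpr h1)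

end Summit.ResolutionOfSingularities.ResolutionOfSingularities.Theorems.FInjectiveMacaulayfication.F4ChartY

end
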